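import Summits.QuantumAdvantage.QuantumAdvantage.Theorems.CubicForrelationNearExactIsExactFourteenSecondLevelSixBalanced
import Summits.QuantumAdvantage.QuantumAdvantage.Theorems.CubicForrelationNearExactIsExactTwoModSixPrep

/-!
# Crux `CubicForrelation.NearExactIsExact` (stmt-QuantumAdvantage-14043) — `n = 6r+2`, TWO-SIDED: level `2r+2` with a BALANCED parity never
  reaches the second boundary `Φ = 1 − 2^{−2r}` (`r ≥ 2`; `r = 2` is the tree's `fo_levelSix_balanced_false`)

Certificate seat `b2b-cforr-cert` (gen 9).  HONEST FRAMING: a theorem uniform in `r` about cubic Boolean pairs on `6r+2` bits — NOT summit progress.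
Level `2r+2`: `W_g = 2^{2r+2}u'`, `p = [u' odd]` quadratic (tower), budget `Σ(u' − 2^{r−1}s)² = 2^{8r+1}(1−Φ) ≤ 2^{6r+1} = N/2`, cost `≥ 1`
per odd point; this file kills `#P = N/2` exactly as at `n = 14`: `p` balanced ⇒ complementing structure `c` (`stub_quadBalancedStructure`),
`Ẽ(x) = e(x)+e(x⊕c)` is `±1` with parametrised `k`-flat sums = `(k+1)`-flat sums of `e` (`fr_sum_peel`; `fs_flat_sum_dvd`, `sl_sum_sZ_flat`),
hence `Ẽ = (−1)^{h₁}`, `h₁` quadratic (`fo_sum_cube_eq_flat`, `bb_moebius_isDegLeFun`) of rank `≤ 4` (`ss_extract3`, `ss_flat_signsum6`),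
likewise `h₂ = h₁ ⊕ p`; `u − 2^r s = (−1)^{h₁} − (−1)^{h₂}` and the period engine (radicals `≥ 2^{n−4}`) gives `Σ|…^| ≤ 2·2^{n/2+9}…`
precisely `2^{6r+4} + 2^{6r+4} < 2^{8r+3}` = pairing.  `tm2_levelTwo_balanced_false`.

References: as in the imported files.  Everything below is proved from Mathlib and the tree; axioms are the standard three.
-/

set_option linter.dupNamespace false -- D-0017: single-problem summit ⇒ `QuantumAdvantage.QuantumAdvantage` by design

noncomputable section

namespace Summit.QuantumAdvantage.QuantumAdvantage.Theorems.CubicForrelation.NearExactIsExact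

open Finset
open Literature.Computability.QuantumComplexity
open Literature.Computability.QuantumComplexity.BuzetChailloux (bxor zeroVec bxor_bxor_cancel_left bxor_zeroVec zeroVec_bxor bxor_comm
  bxor_self)
open Literature.Computability.QuantumComplexity.DerivativeWalsh (W)

variable {n : ℕ}

/-- **Level `2r+2` with a balanced parity never reaches `Φ = 1 − 2^{−2r}` on `6r+2` bits (`r ≥ 2`).**  For cubic `f, g` with
`W_g = 2^{2r+2}·u'`, exactly `2^{6r+1}` odd values of `u'`, and `Φ(f,g) ≥ 1 − (1/2)^{2r}`: contradiction.  Uniform in `r`; NOT summit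
progress. [this work] -/
theorem tm2_levelTwo_balanced_false (r : ℕ) (hr : 2 ≤ r) (f g : (Fin ((3 * r + 1) + (3 * r + 1)) → Bool) → Bool)
    (hf : IsDegLeFun 3 f) (hg : IsDegLeFun 3 g) (u' : (Fin ((3 * r + 1) + (3 * r + 1)) → Bool) → ℤ)
    (hu' : ∀ x, W (fun y => signOf (g y)) x = (2 : ℝ) ^ (2 * r + 2) * (u' x : ℝ))
    (hP : #(univ.filter fun x : Fin ((3 * r + 1) + (3 * r + 1)) → Bool => Odd (u' x)) = 2 ^ (6 * r + 1))
    (hΦ : 1 - (1 / 2 : ℝ) ^ (2 * r) ≤ forrelation f g) : False := by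
  classical
  obtain ⟨t, rfl⟩ : ∃ t, r = t + 2 := ⟨r - 2, by omega⟩
  have hNcard : #(univ : Finset (Fin ((3 * (t + 2) + 1) + (3 * (t + 2) + 1)) → Bool)) = 2 ^ (6 * t + 14) := by
    rw [card_univ, Fintype.card_fun, Fintype.card_bool, Fintype.card_fin]; ring
  have hP' : #(univ.filter fun x : Fin ((3 * (t + 2) + 1) + (3 * (t + 2) + 1)) → Bool => Odd (u' x)) = 2 ^ (6 * t + 13) := by
    rw [hP]; ring
  -- the parity is quadratic
  have hp : IsDegLeFun 2 (fun x => decide (Odd (u' x))) :=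
    stub_walshTower stub_axParity ((3 * (t + 2) + 1) + (3 * (t + 2) + 1)) (2 * (t + 2) + 2) 2 g u' hg hu' (by intro k hk hkn; omega)
  -- `u = 2u'` at the Ax level
  set u : (Fin ((3 * (t + 2) + 1) + (3 * (t + 2) + 1)) → Bool) → ℤ := fun x => 2 * u' x with hudef
  have hu5 : ∀ x, W (fun y => signOf (g y)) x = (2 : ℝ) ^ (2 * (t + 2) + 1) * (u x : ℝ) := by
    intro x; rw [hu' x]; simp only [u]; push_cast; ring
  have hpow2 : (2 : ℤ) ^ (t + 2) = 2 * 2 ^ (t + 1) := by ring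
  have h4 : ∀ x, (u x - 2 ^ (t + 2) * sZ (f x)) ^ 2 = 4 * (u' x - 2 ^ (t + 1) * sZ (f x)) ^ 2 := fun x => by
    simp only [u]; rw [hpow2]; ring
  -- budget `Σ (u' − 2s)² ≤ 2¹³`, spent on the odd set
  have hbud := tms_budget (t + 2) f g u hu5
  have hpow : (2 : ℝ) ^ (8 * (t + 2) + 3) * (1 / 2) ^ (2 * (t + 2)) = 2 ^ (6 * t + 15) := by
    rw [one_div_pow]; field_simp; ring
  have hB0 : (∑ x, (u x - 2 ^ (t + 2) * sZ (f x)) ^ 2 : ℤ) ≤ 2 ^ (6 * t + 15) := by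
    have h1 : 1 - forrelation f g ≤ (1 / 2 : ℝ) ^ (2 * (t + 2)) := by linarith
    have h' : ((∑ x, (u x - 2 ^ (t + 2) * sZ (f x)) ^ 2 : ℤ) : ℝ) ≤ (2 : ℝ) ^ (6 * t + 15) := by
      rw [hbud, ← hpow]
      exact mul_le_mul_of_nonneg_left h1 (by positivity)
    exact_mod_cast h'
  have hB : (∑ x, (u' x - 2 ^ (t + 1) * sZ (f x)) ^ 2 : ℤ) ≤ 2 ^ (6 * t + 13) := by
    have h'' := hB0
    rw [sum_congr rfl fun x _ => h4 x, ← mul_sum, show (2 : ℤ) ^ (6 * t + 15) = 4 * 2 ^ (6 * t + 13) by ring] at h''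
    linarith
  set P := univ.filter (fun x : Fin ((3 * (t + 2) + 1) + (3 * (t + 2) + 1)) → Bool => Odd (u' x)) with hPdef
  have hmemP : ∀ x, x ∈ P ↔ Odd (u' x) := fun x => by simp [hPdef]
  have hsumP : (∑ x, (if Odd (u' x) then 1 else 0 : ℤ)) = #P := by rw [sum_boole]
  have hnonneg : ∀ x, 0 ≤ (u' x - 2 ^ (t + 1) * sZ (f x)) ^ 2 - (if Odd (u' x) then 1 else 0 : ℤ) := by
    intro x
    by_cases h : Odd (u' x)
    · rw [if_pos h]
      have hodd' : Odd (u' x - 2 ^ (t + 1) * sZ (f x)) :=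
        Int.odd_sub.2 (iff_of_true h (by rw [pow_succ]; exact ⟨2 ^ t * sZ (f x), by ring⟩))
      have h0 := Int.odd_iff.1 hodd'
      have : u' x - 2 ^ (t + 1) * sZ (f x) ≤ -1 ∨ 1 ≤ u' x - 2 ^ (t + 1) * sZ (f x) := by omega
      have := tp_sq_ge (k := 1) (by norm_num) this
      linarith
    · rw [if_neg h]; have := sq_nonneg (u' x - 2 ^ (t + 1) * sZ (f x)); linarith
  have hsum0 : ∑ x, ((u' x - 2 ^ (t + 1) * sZ (f x)) ^ 2 - (if Odd (u' x) then 1 else 0 : ℤ)) = 0 := by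
    refine le_antisymm ?_ (sum_nonneg fun x _ => hnonneg x)
    rw [sum_sub_distrib, hsumP, hP']
    push_cast
    linarith
  have hzero' : ∀ x, (u' x - 2 ^ (t + 1) * sZ (f x)) ^ 2 - (if Odd (u' x) then 1 else 0 : ℤ) = 0 :=
    fun x => (sum_eq_zero_iff_of_nonneg fun y _ => hnonneg y).1 hsum0 x (mem_univ x)
  have hoff : ∀ x, ¬ Odd (u' x) → u' x - 2 ^ (t + 1) * sZ (f x) = 0 := by
    intro x hx
    have h := hzero' x
    rw [if_neg hx, sub_zero] at h
    exact (pow_eq_zero_iff two_ne_zero).1 h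
  have hon : ∀ x, Odd (u' x) → u' x - 2 ^ (t + 1) * sZ (f x) = 1 ∨ u' x - 2 ^ (t + 1) * sZ (f x) = -1 := by
    intro x hx
    have h := hzero' x
    rw [if_pos hx] at h
    have h1 : (u' x - 2 ^ (t + 1) * sZ (f x)) * (u' x - 2 ^ (t + 1) * sZ (f x)) = 1 := by rw [← pow_two]; linarith
    exact mul_self_eq_one_iff.1 h1
  have hTeq : (2 : ℝ) ^ (8 * (t + 2) + 3) * (1 - forrelation f g) = 2 ^ (6 * t + 15) := by
    have hT : (∑ x, (u x - 2 ^ (t + 2) * sZ (f x)) ^ 2 : ℤ) = 2 ^ (6 * t + 15) := by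
      have e1 : ∀ x, (u x - 2 ^ (t + 2) * sZ (f x)) ^ 2 = 4 * ((u' x - 2 ^ (t + 1) * sZ (f x)) ^ 2 -
          (if Odd (u' x) then 1 else 0 : ℤ)) + 4 * (if Odd (u' x) then 1 else 0 : ℤ) := fun x => by rw [h4 x]; ring
      rw [sum_congr rfl fun x _ => e1 x, sum_add_distrib, ← mul_sum, ← mul_sum, hsum0, hsumP, hP']
      push_cast; ring
    have h : ((∑ x, (u x - 2 ^ (t + 2) * sZ (f x)) ^ 2 : ℤ) : ℝ) = 2 ^ (6 * t + 15) := by exact_mod_cast hT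
    rw [hbud] at h
    exact h
  -- the parity is balanced, hence has a complementing structure `c`
  have hbal : ∑ y, signOf (decide (Odd (u' y))) = 0 := by
    rw [fc_sum_signOf_eq_card]
    have hfilt : (univ.filter fun x : Fin ((3 * (t + 2) + 1) + (3 * (t + 2) + 1)) → Bool => decide (Odd (u' x)) = true) = P :=
      filter_congr fun x _ => by simp
    rw [hfilt, hP']; push_cast; ring
  obtain ⟨c, hc0, hc⟩ := stub_quadBalancedStructure ((3 * (t + 2) + 1) + (3 * (t + 2) + 1)) (fun x => decide (Odd (u' x))) hp hbal
  have hc' : ∀ y, Odd (u' (bxor y c)) ↔ ¬ Odd (u' y) := by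
    intro y
    have h := hc y
    by_cases h1 : Odd (u' y) <;> simp [h1] at h ⊢ <;> exact h
  -- the residual and its `c`-periodic extension
  set e : (Fin ((3 * (t + 2) + 1) + (3 * (t + 2) + 1)) → Bool) → ℤ := fun x => u' x - 2 ^ (t + 1) * sZ (f x) with hedef
  set E : (Fin ((3 * (t + 2) + 1) + (3 * (t + 2) + 1)) → Bool) → ℤ := fun x => e x + e (bxor x c) with hEdef
  have hE1 : ∀ x, E x = 1 ∨ E x = -1 := by
    intro x
    by_cases hx : Odd (u' x)
    · have h2 : e (bxor x c) = 0 := hoff _ (fun h => (hc' x).1 h hx)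
      simp only [E, h2, add_zero]; exact hon x hx
    · have h1 : e x = 0 := hoff _ hx
      simp only [E, h1, zero_add]; exact hon _ ((hc' x).2 hx)
  set h₁ : (Fin ((3 * (t + 2) + 1) + (3 * (t + 2) + 1)) → Bool) → Bool := fun x => decide (E x = -1) with hh₁
  have hEh : ∀ x, E x = sZ (h₁ x) := fun x => fl1_sZ_decide (hE1 x)
  -- parametrised flat sums of `E` are flat sums of `e` with the extra direction `c`
  have hpeel : ∀ {k : ℕ} (b : Fin ((3 * (t + 2) + 1) + (3 * (t + 2) + 1)) → Bool) (a : Fin k → Fin ((3 * (t + 2) + 1) + (3 * (t + 2) + 1)) → Bool),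
      ∑ ε : Fin k → Bool, E (fun j => b j ^^ decide (Odd #(univ.filter fun i => ε i && a i j))) =
      ∑ ε : Fin (k + 1) → Bool, e (fun j => b j ^^ decide (Odd #(univ.filter fun i =>
        ε i && (Matrix.vecCons c a : Fin (k + 1) → Fin ((3 * (t + 2) + 1) + (3 * (t + 2) + 1)) → Bool) i j))) := by
    intro k b a
    rw [fr_sum_peel e b c a, ← sum_add_distrib]
  have hflat : ∀ {k : ℕ} (b : Fin ((3 * (t + 2) + 1) + (3 * (t + 2) + 1)) → Bool) (a : Fin (k + 1) → Fin ((3 * (t + 2) + 1) + (3 * (t + 2) + 1)) → Bool) (m : ℕ),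
      2 * (t + 2) + 2 + m ≤ (k + 1) + (((3 * (t + 2) + 1) + (3 * (t + 2) + 1)) - (k + 1) + 2) / 3 → (2 : ℤ) ^ m ∣ 2 ^ (t + 1) * 2 ^ ((k + 1 + 2) / 3) →
      (2 : ℤ) ^ m ∣ ∑ ε : Fin (k + 1) → Bool, e (fun j => b j ^^ decide (Odd #(univ.filter fun i => ε i && a i j))) := by
    intro k b a m hm hm2
    have h1 := fs_flat_sum_dvd (e := m) g u' hg hu' b a hm
    obtain ⟨zf, hzf⟩ := sl_sum_sZ_flat f hf b a
    have h2 : ∑ ε : Fin (k + 1) → Bool, e (fun j => b j ^^ decide (Odd #(univ.filter fun i => ε i && a i j))) =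
        ∑ ε : Fin (k + 1) → Bool, u' (fun j => b j ^^ decide (Odd #(univ.filter fun i => ε i && a i j))) -
        2 ^ (t + 1) * ∑ ε : Fin (k + 1) → Bool, sZ (f (fun j => b j ^^ decide (Odd #(univ.filter fun i => ε i && a i j)))) := by
      simp only [e]; rw [sum_sub_distrib, mul_sum]
    rw [h2, hzf, ← mul_assoc]
    exact dvd_sub h1 (Dvd.dvd.mul_right hm2 _)
  -- `E` is `(−1)^{h₁}` with `h₁` QUADRATIC: coordinate cube sums of `E` are `≡ 0 (mod 4)`
  have hh₁ : IsDegLeFun 2 h₁ := by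
    refine bb_moebius_isDegLeFun 2 _ fun I hI => ?_
    have hk : #I ≤ ((3 * (t + 2) + 1) + (3 * (t + 2) + 1)) := (card_le_univ I).trans_eq (Fintype.card_fin _)
    obtain ⟨kc, hkI⟩ : ∃ kc, #I = kc + 3 := ⟨#I - 3, by omega⟩
    have h4c : (4 : ℤ) ∣ ∑ x ∈ univ.filter (fun x : Fin ((3 * (t + 2) + 1) + (3 * (t + 2) + 1)) → Bool => ∀ i, x i = true → i ∈ I), E x := by
      rw [fo_sum_cube_eq_flat E I, hpeel, show (4 : ℤ) = 2 ^ 2 by norm_num]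
      exact hflat (k := #I) zeroVec (Matrix.vecCons c fun i : Fin #I =>
        (Pi.single (I.orderEmbOfFin rfl i) true : Fin ((3 * (t + 2) + 1) + (3 * (t + 2) + 1)) → Bool)) 2 (by omega)
        (by obtain ⟨m', hm'⟩ : ∃ m', (#I + 1 + 2) / 3 = m' + 2 := ⟨(#I + 1 + 2) / 3 - 2, by omega⟩
            rw [hm']; exact ⟨2 ^ (t + 1) * 2 ^ m', by ring⟩)
    have hsum : ∑ x ∈ univ.filter (fun x : Fin ((3 * (t + 2) + 1) + (3 * (t + 2) + 1)) → Bool => ∀ i, x i = true → i ∈ I), E x =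
        2 ^ #I - 2 * #(univ.filter fun x : Fin ((3 * (t + 2) + 1) + (3 * (t + 2) + 1)) → Bool => (∀ i, x i = true → i ∈ I) ∧ h₁ x = true) := by
      rw [sum_congr rfl fun x _ => (hEh x).trans (fo_sZ_eq (h₁ x)), sum_sub_distrib, ← mul_sum, sum_boole, filter_filter,
        sum_const, bb_card_cube]
      ring
    rw [hsum, hkI, show (2 : ℤ) ^ (kc + 3) = 4 * (2 * 2 ^ kc) by ring] at h4c
    have h2 : (4 : ℤ) ∣ 2 * #(univ.filter fun x : Fin ((3 * (t + 2) + 1) + (3 * (t + 2) + 1)) → Bool => (∀ i, x i = true → i ∈ I) ∧ h₁ x = true) := by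
      have := dvd_sub (dvd_mul_right 4 (2 * 2 ^ kc)) h4c
      rwa [sub_sub_cancel] at this
    obtain ⟨q, hq⟩ := h2
    refine Nat.even_iff.2 ?_
    omega
  -- 6-flat sums of `E` are `≡ 0 (mod 16)`; hence the radical of `h₁` is large (rank `≤ 4`)
  have h16 : ∀ (b : Fin ((3 * (t + 2) + 1) + (3 * (t + 2) + 1)) → Bool) (a : Fin 6 → Fin ((3 * (t + 2) + 1) + (3 * (t + 2) + 1)) → Bool),
      (16 : ℤ) ∣ ∑ ε : Fin 6 → Bool, E (fun j => b j ^^ decide (Odd #(univ.filter fun i => ε i && a i j))) := by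
    intro b a
    rw [hpeel, show (16 : ℤ) = 2 ^ 4 by norm_num]
    exact hflat b (Matrix.vecCons c a) 4 (by omega) ⟨2 ^ t, by ring⟩
  set R₁ := univ.filter (fun a : Fin ((3 * (t + 2) + 1) + (3 * (t + 2) + 1)) → Bool => ∀ b, (h₁ zeroVec ^^ h₁ a ^^ h₁ b ^^ h₁ (bxor a b)) = false) with hR₁
  have hR₁ge : 2 ^ (6 * t + 10) ≤ #R₁ := by
    by_contra hlt
    push Not at hlt
    obtain ⟨a₀, a₁, a₂, a₃, a₄, a₅, h01, h23, h45, h02, h03, h12, h13, h04, h05, h14, h15, h24, h25, h34, h35⟩ :=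
      ss_extract3 h₁ hh₁ (by rw [← hR₁, show (2 : ℕ) ^ ((3 * (t + 2) + 1) + (3 * (t + 2) + 1)) = 16 * 2 ^ (6 * t + 10) by ring]; omega)
    have hss := ss_flat_signsum6 h₁ hh₁ a₀ a₁ a₂ a₃ a₄ a₅ h01 h23 h45 h02 h03 h12 h13 h04 h05 h14 h15 h24 h25 h34 h35 zeroVec
    have hcast : ∑ ε : Fin 6 → Bool, signOf (h₁ (fun j => zeroVec j ^^ decide (Odd #(univ.filter fun i =>
        ε i && (![a₀, a₁, a₂, a₃, a₄, a₅] i) j)))) =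
        ((∑ ε : Fin 6 → Bool, E (fun j => zeroVec j ^^ decide (Odd #(univ.filter fun i =>
          ε i && (![a₀, a₁, a₂, a₃, a₄, a₅] i) j))) : ℤ) : ℝ) := by
      push_cast
      exact sum_congr rfl fun ε _ => by rw [hEh, tp_sZ_cast]
    have hd := h16 zeroVec ![a₀, a₁, a₂, a₃, a₄, a₅]
    rw [hcast] at hss
    rcases hss with h8 | h8
    · have h8' : (∑ ε : Fin 6 → Bool, E (fun j => zeroVec j ^^ decide (Odd #(univ.filter fun i =>
          ε i && (![a₀, a₁, a₂, a₃, a₄, a₅] i) j))) : ℤ) = 8 := by exact_mod_cast h8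
      rw [h8'] at hd; norm_num at hd
    · have h8' : (∑ ε : Fin 6 → Bool, E (fun j => zeroVec j ^^ decide (Odd #(univ.filter fun i =>
          ε i && (![a₀, a₁, a₂, a₃, a₄, a₅] i) j))) : ℤ) = -8 := by exact_mod_cast h8
      rw [h8'] at hd; norm_num at hd
  -- the twisted pattern `h₂ = h₁ ⊕ p` is quadratic of rank `≤ 4` as well
  set h₂ : (Fin ((3 * (t + 2) + 1) + (3 * (t + 2) + 1)) → Bool) → Bool := fun x => h₁ x ^^ decide (Odd (u' x)) with hh₂
  have hh₂ : IsDegLeFun 2 h₂ := bb_isDegLeFun_bxor hh₁ hp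
  have hE2 : ∀ x, (sZ (h₂ x) : ℤ) = E x - 2 * e x := by
    intro x
    by_cases hx : Odd (u' x)
    · have h2 : e (bxor x c) = 0 := hoff _ (fun h => (hc' x).1 h hx)
      have hEx : E x = e x := by simp only [E, h2, add_zero]
      have hb : h₂ x = !h₁ x := by simp only [h₂, decide_eq_true hx, Bool.xor_true]
      rw [hb, hEx.symm.trans (hEh x), hEh x]
      cases h₁ x <;> simp [sZ]
    · have h1 : e x = 0 := hoff _ hx
      have hb : h₂ x = h₁ x := by simp only [h₂, decide_eq_false hx, Bool.xor_false]
      rw [hb, h1, hEh x]; ring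
  have h16' : ∀ (b : Fin ((3 * (t + 2) + 1) + (3 * (t + 2) + 1)) → Bool) (a : Fin 6 → Fin ((3 * (t + 2) + 1) + (3 * (t + 2) + 1)) → Bool),
      (16 : ℤ) ∣ ∑ ε : Fin 6 → Bool, sZ (h₂ (fun j => b j ^^ decide (Odd #(univ.filter fun i => ε i && a i j)))) := by
    intro b a
    rw [sum_congr rfl fun ε _ => hE2 _, sum_sub_distrib, ← mul_sum]
    refine dvd_sub (h16 b a) ?_
    obtain ⟨a5, ha5⟩ : ∃ a5 : Fin 5 → Fin ((3 * (t + 2) + 1) + (3 * (t + 2) + 1)) → Bool, ∃ t', a = Matrix.vecCons t' a5 :=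
      ⟨Matrix.vecTail a, Matrix.vecHead a, (Matrix.cons_head_tail a).symm⟩
    obtain ⟨t', rfl⟩ := ha5
    have := hflat b (Matrix.vecCons t' a5) 3 (by omega) ⟨2 ^ t, by ring⟩
    rw [show (16 : ℤ) = 2 * 2 ^ 3 by norm_num]
    exact mul_dvd_mul_left 2 this
  set R₂ := univ.filter (fun a : Fin ((3 * (t + 2) + 1) + (3 * (t + 2) + 1)) → Bool => ∀ b, (h₂ zeroVec ^^ h₂ a ^^ h₂ b ^^ h₂ (bxor a b)) = false) with hR₂
  have hR₂ge : 2 ^ (6 * t + 10) ≤ #R₂ := by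
    by_contra hlt
    push Not at hlt
    obtain ⟨a₀, a₁, a₂, a₃, a₄, a₅, h01, h23, h45, h02, h03, h12, h13, h04, h05, h14, h15, h24, h25, h34, h35⟩ :=
      ss_extract3 h₂ hh₂ (by rw [← hR₂, show (2 : ℕ) ^ ((3 * (t + 2) + 1) + (3 * (t + 2) + 1)) = 16 * 2 ^ (6 * t + 10) by ring]; omega)
    have hss := ss_flat_signsum6 h₂ hh₂ a₀ a₁ a₂ a₃ a₄ a₅ h01 h23 h45 h02 h03 h12 h13 h04 h05 h14 h15 h24 h25 h34 h35 zeroVec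
    have hcast : ∑ ε : Fin 6 → Bool, signOf (h₂ (fun j => zeroVec j ^^ decide (Odd #(univ.filter fun i =>
        ε i && (![a₀, a₁, a₂, a₃, a₄, a₅] i) j)))) =
        ((∑ ε : Fin 6 → Bool, sZ (h₂ (fun j => zeroVec j ^^ decide (Odd #(univ.filter fun i =>
          ε i && (![a₀, a₁, a₂, a₃, a₄, a₅] i) j)))) : ℤ) : ℝ) := by
      push_cast
      exact sum_congr rfl fun ε _ => by rw [tp_sZ_cast]
    have hd := h16' zeroVec ![a₀, a₁, a₂, a₃, a₄, a₅]
    rw [hcast] at hss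
    rcases hss with h8 | h8
    · have h8' : (∑ ε : Fin 6 → Bool, sZ (h₂ (fun j => zeroVec j ^^ decide (Odd #(univ.filter fun i =>
          ε i && (![a₀, a₁, a₂, a₃, a₄, a₅] i) j)))) : ℤ) = 8 := by exact_mod_cast h8
      rw [h8'] at hd; norm_num at hd
    · have h8' : (∑ ε : Fin 6 → Bool, sZ (h₂ (fun j => zeroVec j ^^ decide (Odd #(univ.filter fun i =>
          ε i && (![a₀, a₁, a₂, a₃, a₄, a₅] i) j)))) : ℤ) = -8 := by exact_mod_cast h8
      rw [h8'] at hd; norm_num at hd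
  -- radicals: closure and periods up to sign
  have hrad0 : ∀ (q : (Fin ((3 * (t + 2) + 1) + (3 * (t + 2) + 1)) → Bool) → Bool),
      zeroVec ∈ univ.filter (fun a : Fin ((3 * (t + 2) + 1) + (3 * (t + 2) + 1)) → Bool => ∀ b, (q zeroVec ^^ q a ^^ q b ^^ q (bxor a b)) = false) := by
    intro q
    refine mem_filter.2 ⟨mem_univ _, fun b => ?_⟩
    rw [zeroVec_bxor]; cases q zeroVec <;> cases q b <;> rfl
  have hradd : ∀ (q : (Fin ((3 * (t + 2) + 1) + (3 * (t + 2) + 1)) → Bool) → Bool), IsDegLeFun 2 q →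
      ∀ a ∈ univ.filter (fun a : Fin ((3 * (t + 2) + 1) + (3 * (t + 2) + 1)) → Bool => ∀ b, (q zeroVec ^^ q a ^^ q b ^^ q (bxor a b)) = false),
      ∀ a' ∈ univ.filter (fun a : Fin ((3 * (t + 2) + 1) + (3 * (t + 2) + 1)) → Bool => ∀ b, (q zeroVec ^^ q a ^^ q b ^^ q (bxor a b)) = false),
        bxor a a' ∈ univ.filter (fun a : Fin ((3 * (t + 2) + 1) + (3 * (t + 2) + 1)) → Bool => ∀ b, (q zeroVec ^^ q a ^^ q b ^^ q (bxor a b)) = false) := by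
    intro q hq a ha a' ha'
    refine mem_filter.2 ⟨mem_univ _, fun b => ?_⟩
    rw [es_B_add_left q hq a a' b, (mem_filter.1 ha).2 b, (mem_filter.1 ha').2 b]
    rfl
  have hper : ∀ (q : (Fin ((3 * (t + 2) + 1) + (3 * (t + 2) + 1)) → Bool) → Bool),
      ∀ a ∈ univ.filter (fun a : Fin ((3 * (t + 2) + 1) + (3 * (t + 2) + 1)) → Bool => ∀ b, (q zeroVec ^^ q a ^^ q b ^^ q (bxor a b)) = false),
      ∃ cc : ℝ, (cc = 1 ∨ cc = -1) ∧ ∀ x, signOf (q (bxor x a)) = cc * signOf (q x) := by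
    intro q a ha
    refine ⟨signOf (q zeroVec ^^ q a), ?_, fun x => ?_⟩
    · unfold signOf; split_ifs <;> simp
    · have h := (mem_filter.1 ha).2 x
      rw [bxor_comm] at h
      have e1 : q (bxor x a) = (q x ^^ (q zeroVec ^^ q a)) := by
        revert h; cases q zeroVec <;> cases q a <;> cases q x <;> cases q (bxor x a) <;> decide
      rw [e1, signOf_xor]; ring
  -- the two `L¹` bounds
  set A₁ : (Fin ((3 * (t + 2) + 1) + (3 * (t + 2) + 1)) → Bool) → ℝ := fun x => signOf (h₁ x) with hA₁
  set A₂ : (Fin ((3 * (t + 2) + 1) + (3 * (t + 2) + 1)) → Bool) → ℝ := fun x => signOf (h₂ x) with hA₂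
  have hL1 : ∀ (q : (Fin ((3 * (t + 2) + 1) + (3 * (t + 2) + 1)) → Bool) → Bool), IsDegLeFun 2 q →
      2 ^ (6 * t + 10) ≤ #(univ.filter (fun a : Fin ((3 * (t + 2) + 1) + (3 * (t + 2) + 1)) → Bool => ∀ b, (q zeroVec ^^ q a ^^ q b ^^ q (bxor a b)) = false)) →
      ∑ y, |W (fun x => signOf (q x)) y| ≤ (2 : ℝ) ^ (6 * t + 16) := by
    intro q hq hR
    have hb := fp_l1_sq_mul_le (fun x => signOf (q x)) univ _ (fun x _ => by unfold signOf; split_ifs <;> simp)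
      (fun x hx => absurd (mem_univ x) hx) (hrad0 q) (hradd q hq) (hper q)
    rw [hNcard] at hb
    have hRr : ((2 : ℝ) ^ (6 * t + 10)) ≤ #(univ.filter (fun a : Fin ((3 * (t + 2) + 1) + (3 * (t + 2) + 1)) → Bool => ∀ b, (q zeroVec ^^ q a ^^ q b ^^ q (bxor a b)) = false)) := by
      exact_mod_cast hR
    have hnn : 0 ≤ ∑ y, |W (fun x => signOf (q x)) y| := sum_nonneg fun y _ => abs_nonneg _
    push_cast at hb
    have h2 : (∑ y, |W (fun x => signOf (q x)) y|) ^ 2 * (2 : ℝ) ^ (6 * t + 10) ≤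
        (∑ y, |W (fun x => signOf (q x)) y|) ^ 2 *
          #(univ.filter (fun a : Fin ((3 * (t + 2) + 1) + (3 * (t + 2) + 1)) → Bool => ∀ b, (q zeroVec ^^ q a ^^ q b ^^ q (bxor a b)) = false)) :=
      mul_le_mul_of_nonneg_left hRr (sq_nonneg _)
    have h3 : (∑ y, |W (fun x => signOf (q x)) y|) ^ 2 * (2 : ℝ) ^ (6 * t + 10) ≤ ((2 : ℝ) ^ (6 * t + 16)) ^ 2 * 2 ^ (6 * t + 10) := by
      refine (h2.trans hb).trans (le_of_eq ?_)
      rw [show (((3 * (t + 2) + 1) + (3 * (t + 2) + 1)) : ℕ) = 6 * t + 14 by ring]; ring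
    have h4' : (∑ y, |W (fun x => signOf (q x)) y|) ^ 2 ≤ ((2 : ℝ) ^ (6 * t + 16)) ^ 2 := le_of_mul_le_mul_right h3 (by positivity)
    exact (pow_le_pow_iff_left₀ hnn (by positivity) two_ne_zero).1 h4'
  have hX := hL1 h₁ hh₁ hR₁ge
  have hY := hL1 h₂ hh₂ hR₂ge
  -- decomposition `u − 4s = A₁ − A₂` and the pairing
  have hdecomp : (fun x => (u x : ℝ) - (2 : ℝ) ^ (t + 2) * signOf (f x)) = fun x => A₁ x + (-1) * A₂ x := by
    funext x
    have h2 : (u x : ℝ) - (2 : ℝ) ^ (t + 2) * signOf (f x) = 2 * ((e x : ℤ) : ℝ) := by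
      simp only [u, e]; push_cast; rw [tp_sZ_cast]; ring
    have h3 : (2 : ℝ) * ((e x : ℤ) : ℝ) = ((E x : ℤ) : ℝ) - ((sZ (h₂ x) : ℤ) : ℝ) := by
      rw [hE2 x]; push_cast; ring
    rw [h2, h3, hEh x, tp_sZ_cast, tp_sZ_cast]
    simp only [A₁, A₂]; ring
  have hpair := tms_pairing (t + 2) f g u hu5
  rw [show (2 : ℝ) ^ (10 * (t + 2) + 3) = 2 ^ (2 * t + 4) * 2 ^ (8 * (t + 2) + 3) by ring, mul_assoc, hTeq, hdecomp] at hpair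
  have e2 : ∀ y, signOf (g y) * W (fun x => A₁ x + (-1) * A₂ x) y =
      signOf (g y) * W A₁ y + (-1) * (signOf (g y) * W A₂ y) := fun y => by
    rw [sp_W_add, fl1_W_smul]; ring
  rw [sum_congr rfl fun y _ => e2 y, sum_add_distrib, ← mul_sum] at hpair
  have hP1 : ∑ y, signOf (g y) * W A₁ y ≤ ∑ y, |W A₁ y| := fl1_pairing_le_l1 g (W A₁)
  have hP2 : |∑ y, signOf (g y) * W A₂ y| ≤ ∑ y, |W A₂ y| :=
    (abs_sum_le_sum_abs _ _).trans (sum_le_sum fun y _ => by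
      rw [abs_mul]; unfold signOf; split_ifs <;> norm_num)
  have hP2' := (abs_le.1 hP2).1
  have h23 : (2 : ℝ) ^ (2 * t + 4) * 2 ^ (6 * t + 15) = 2 ^ (8 * t + 19) := by ring
  rw [h23] at hpair
  simp only [A₁, A₂] at hP1 hP2' hpair hX hY
  have hbig : (2 : ℝ) ^ (6 * t + 16) + 2 ^ (6 * t + 16) < 2 ^ (8 * t + 19) := by
    have e : (2 : ℝ) ^ (6 * t + 16) + 2 ^ (6 * t + 16) = 2 ^ (6 * t + 17) := by ring
    rw [e]
    exact pow_lt_pow_right₀ (by norm_num) (by omega)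
  linarith

end Summit.QuantumAdvantage.QuantumAdvantage.Theorems.CubicForrelation.NearExactIsExact

end
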